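import Mathlib
import Literature.NumberTheory.LFunctions.Zhang2022.Section13Eq1311Terms
import Literature.NumberTheory.LFunctions.Zhang2022.Section13C137
import Literature.NumberTheory.LFunctions.Zhang2022.Section14Eq143Core
import HarnessLib

/-!
# Zhang (2022) §13 p. 75, (13.11) «𝓔 = o(𝔓)» — the assembly: the leaf `Skeleton.Eq1311Rel c′ c₀` from
# the eight quadratic zero-sum bounds (kernel edge; the bounds are the lane's Z-POLY / Z-L theorems)

Topic `Literature/NumberTheory/LFunctions/Zhang2022` (Landau–Siegel audit tree; verdict-neutral).
Y. Zhang, *Discrete mean estimates and the Landau–Siegel zero*, arXiv:2211.02515v1 (2022)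
[Zhang2022LandauSiegel], §13 p. 75, (13.11): "Combining (2.34), Cauchy's inequality, Proposition 7.1,
Lemma 5.9, 6.1 and 3.3, we can verify that `𝓔 = o(𝔓)`" — NOT carried out in print (GAP-LEDGER
G-L3t6-3). Lane ZHANG-L WP14, leaf `Skeleton.Eq1311Rel c′ c₀` (relative reading of record: `𝓔 ≤ ε(𝔞+1)𝔓`
eventually, `SkeletonEvalRel`), owner zl-w14-p5, frame of record CL-10 (W14-R2). **An unrefereed
manuscript under adjudication; nothing here asserts its Theorems 1–2.**

`eq1311Rel_of_zeroSums`: for any `c′` and any `c₀ > 0`, the leaf `Eq1311Rel c′ c₀` follows from eventual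
bounds for the eight quadratic zero-sums `Q(F) = ΣΣ_{ψ∈Ψ₁, ρ∈𝔷(ψ)} |L(ρ+β₁)/L′(ρ)||F(ρ,ψ)|²|ω(ρ)|` of
the assembler's interface (`Section13Eq1311Terms.frakE_le_of_zeroSum_bounds`), in the shapes the lane
proves them (typer scratch v6 / W14-R2c): `Q(L₂L₃) ≤ C·P²·𝓛⁴⁵` (the one large-sieve-scale input, paid by
`t₀⁻¹ = 𝓛⁻⁵¹⁹`), `Q(B) ≤ C𝔓𝓛⁴⁵`, `Q(L(·+β)) ≤ C𝔓𝓛¹⁸`, `Q(N(·+β)B) ≤ C𝔓𝓛⁵⁵`, `Q(D_{T³}(·+β)B) ≤ C𝔓𝓛⁵⁵`,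
`Q(N(·+β)) ≤ C𝔓𝓛¹¹` (`Re β = 0`; `‖β‖ ≤ 1` for the `L`-sum). Arithmetic of the budget (𝔓-units, with
`P² ≤ 2𝔓𝓛⁷⁷` from (2.9), tree `Typed.Sec14.Eq143.bigP_sq_le`): `t₀⁻¹√(Q₂₃Q_B) ≤ K𝔓𝓛^{84−519}`, `𝓛⁻¹²³(…) ≤ K𝔓𝓛^{37−123}`,
`𝓛⁻⁶⁸·2√π𝓛¹⁵(…) ≤ K𝔓𝓛^{37−53}`, `e^{−c₀𝓛¹⁰}(…) ≤ K𝔓𝓛³²e^{−c₀𝓛¹⁰} ≤ 256K𝔓/(c₀⁴𝓛⁸)`; all `≤ K′𝔓𝓛⁻⁸ ≤ ε(𝔞+1)𝔓`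
for `D` large. The closer `eq1311Rel_of_prop22 : 0 ≤ c′ → Prop22 c′ → Eq1311Rel c′ c137` is this edge at the
landed zero-sum theorems (companion file `Section13Eq1311Holds`).

## References

* Y. Zhang, arXiv:2211.02515v1 (2022), §13 (13.11) p. 75; §2 (2.9), (2.13).
  [cite: Zhang2022LandauSiegel, §13 (13.11) p.75]
-/

noncomputable section

open Complex Real Finset Filter

namespace Literature.NumberTheory.LFunctions.Zhang2022.Typed.Section13

open Skeleton

/-! ## Elementary sizes -/

/-- `√(C₁Xℓ^a)·√(C₂Xℓ^b) ≤ √(C₁C₂)·X·ℓ^k` whenever `a + b ≤ 2k` (`C₁, C₂, X ≥ 0`, `ℓ ≥ 1`).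
[cite: Zhang2022LandauSiegel, §13 (13.11) p.75 ("Cauchy's inequality")] -/
theorem sqrt_mul_sqrt_le {C₁ C₂ X ℓ : ℝ} (h1 : 0 ≤ C₁) (h2 : 0 ≤ C₂) (hX : 0 ≤ X) (hℓ : 1 ≤ ℓ)
    {a b k : ℕ} (hk : a + b ≤ 2 * k) :
    Real.sqrt (C₁ * X * ℓ ^ a) * Real.sqrt (C₂ * X * ℓ ^ b) ≤ Real.sqrt (C₁ * C₂) * X * ℓ ^ k := by
  have hℓ0 : 0 ≤ ℓ := by linarith
  rw [← Real.sqrt_mul (by positivity)]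
  have hle : C₁ * X * ℓ ^ a * (C₂ * X * ℓ ^ b) ≤ (Real.sqrt (C₁ * C₂) * X * ℓ ^ k) ^ 2 := by
    rw [mul_pow, mul_pow, Real.sq_sqrt (mul_nonneg h1 h2), ← pow_mul]
    have hab : ℓ ^ a * ℓ ^ b ≤ ℓ ^ (k * 2) := by
      rw [← pow_add]; exact pow_le_pow_right₀ hℓ (by omega)
    calc C₁ * X * ℓ ^ a * (C₂ * X * ℓ ^ b) = C₁ * C₂ * X ^ 2 * (ℓ ^ a * ℓ ^ b) := by ring
      _ ≤ C₁ * C₂ * X ^ 2 * ℓ ^ (k * 2) := mul_le_mul_of_nonneg_left hab (by positivity)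
  calc Real.sqrt (C₁ * X * ℓ ^ a * (C₂ * X * ℓ ^ b))
      ≤ Real.sqrt ((Real.sqrt (C₁ * C₂) * X * ℓ ^ k) ^ 2) := Real.sqrt_le_sqrt hle
    _ = Real.sqrt (C₁ * C₂) * X * ℓ ^ k := Real.sqrt_sq (by positivity)

/-- `e^{−c₀y}·y⁴ ≤ 256/c₀⁴` for `c₀ > 0`, `y ≥ 0` (`e^{x} ≥ (1 + x/4)⁴ ≥ (x/4)⁴`).
[cite: Zhang2022LandauSiegel, §6 Lemma 6.1 (the `ε = exp{−c𝓛¹⁰}`)] -/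
theorem exp_neg_mul_mul_pow_four_le {c₀ y : ℝ} (hc₀ : 0 < c₀) (hy : 0 ≤ y) :
    Real.exp (-c₀ * y) * y ^ 4 ≤ 256 / c₀ ^ 4 := by
  have hx : 0 ≤ c₀ * y := mul_nonneg hc₀.le hy
  have h4 : (c₀ * y / 4) ^ 4 ≤ Real.exp (c₀ * y) := by
    have h1 : c₀ * y / 4 + 1 ≤ Real.exp (c₀ * y / 4) := Real.add_one_le_exp _
    have h0 : 0 ≤ c₀ * y / 4 := by positivity
    calc (c₀ * y / 4) ^ 4 ≤ (c₀ * y / 4 + 1) ^ 4 := by gcongr; linarith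
      _ ≤ Real.exp (c₀ * y / 4) ^ 4 := by gcongr
      _ = Real.exp (c₀ * y) := by rw [← Real.exp_nat_mul]; ring_nf
  have hexp : 0 < Real.exp (c₀ * y) := Real.exp_pos _
  rw [show -c₀ * y = -(c₀ * y) by ring, Real.exp_neg, inv_mul_le_iff₀ hexp]
  have hy4 : y ^ 4 = (c₀ * y / 4) ^ 4 * (256 / c₀ ^ 4) := by
    field_simp
    ring
  rw [hy4]
  exact mul_le_mul_of_nonneg_right h4 (by positivity)

/-! ## The leaf from the eight zero-sum bounds -/

/-- **(13.11) from the eight quadratic zero-sum bounds** (kernel edge; the frame of record CL-10): for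
every `c′` and every `c₀ > 0`, if eventually (in `D`, for every real primitive `χ`, under (A) where the
bound needs it) `Q(L₂L₃) ≤ C·P²·𝓛⁴⁵`, `Q(B) ≤ C𝔓𝓛⁴⁵`, `Q(L(·+β)) ≤ C𝔓𝓛¹⁸` (`Re β = 0`, `‖β‖ ≤ 1`),
`Q(N(·+β)B) ≤ C𝔓𝓛⁵⁵`, `Q(D_{T³}(·+β)B) ≤ C𝔓𝓛⁵⁵`, `Q(N(·+β)) ≤ C𝔓𝓛¹¹` (`Re β = 0`), then
`Skeleton.Eq1311Rel c′ c₀`: `𝓔 ≤ ε(𝔞+1)𝔓` eventually, every `ε > 0`.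
[cite: Zhang2022LandauSiegel, §13 (13.11) p.75] -/
theorem eq1311Rel_of_zeroSums (c' c₀ : ℝ) (hc₀ : 0 < c₀)
    (hZ23 : ∃ C : ℝ, ForAllLarge fun D _ χ => AssumptionA D χ →
      ∑ x ∈ finsetOf (PsiOne χ), ∑ ρ ∈ finsetOf (zeroSet D x),
        ‖x.ψ.LFunction (ρ + beta1 c' D) / deriv x.ψ.LFunction ρ‖ *
          ‖x.ψ.LFunction (ρ + beta2 c' D) * x.ψ.LFunction (ρ + beta3 c' D)‖ ^ 2 * ‖omegaW D ρ‖ ≤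
        C * bigP D ^ 2 * ell D ^ 45)
    (hZB : ∃ C : ℝ, 0 ≤ C ∧ ForAllLarge fun D _ χ =>
      ∑ x ∈ finsetOf (PsiOne χ), ∑ ρ ∈ finsetOf (zeroSet D x),
        ‖x.ψ.LFunction (ρ + beta1 c' D) / deriv x.ψ.LFunction ρ‖ * ‖Bpoly χ x ρ‖ ^ 2 *
          ‖omegaW D ρ‖ ≤ C * frakP D * ell D ^ 45)
    (hZL : ∃ C : ℝ, ForAllLarge fun D _ χ => AssumptionA D χ → ∀ β : ℂ, β.re = 0 → ‖β‖ ≤ 1 →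
      ∑ x ∈ finsetOf (PsiOne χ), ∑ ρ ∈ finsetOf (zeroSet D x),
        ‖x.ψ.LFunction (ρ + beta1 c' D) / deriv x.ψ.LFunction ρ‖ *
          ‖x.ψ.LFunction (ρ + β)‖ ^ 2 * ‖omegaW D ρ‖ ≤ C * frakP D * ell D ^ 18)
    (hZNB : ∃ C : ℝ, 0 ≤ C ∧ ForAllLarge fun D _ χ => ∀ β : ℂ, β.re = 0 →
      ∑ x ∈ finsetOf (PsiOne χ), ∑ ρ ∈ finsetOf (zeroSet D x),
        ‖x.ψ.LFunction (ρ + beta1 c' D) / deriv x.ψ.LFunction ρ‖ *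
          ‖Nchar D (psiFn x) (ρ + β) * Bpoly χ x ρ‖ ^ 2 * ‖omegaW D ρ‖ ≤ C * frakP D * ell D ^ 55)
    (hZDB : ∃ C : ℝ, 0 ≤ C ∧ ForAllLarge fun D _ χ => ∀ β : ℂ, β.re = 0 →
      ∑ x ∈ finsetOf (PsiOne χ), ∑ ρ ∈ finsetOf (zeroSet D x),
        ‖x.ψ.LFunction (ρ + beta1 c' D) / deriv x.ψ.LFunction ρ‖ *
          ‖(∑ n ∈ Finset.Ico 1 ⌈bigT D ^ 3⌉₊, x.ψ (n : ZMod x.p) * (n : ℂ) ^ (-(ρ + β))) *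
            Bpoly χ x ρ‖ ^ 2 * ‖omegaW D ρ‖ ≤ C * frakP D * ell D ^ 55)
    (hZN : ∃ C : ℝ, 0 ≤ C ∧ ForAllLarge fun D _ χ => ∀ β : ℂ, β.re = 0 →
      ∑ x ∈ finsetOf (PsiOne χ), ∑ ρ ∈ finsetOf (zeroSet D x),
        ‖x.ψ.LFunction (ρ + beta1 c' D) / deriv x.ψ.LFunction ρ‖ *
          ‖Nchar D (psiFn x) (ρ + β)‖ ^ 2 * ‖omegaW D ρ‖ ≤ C * frakP D * ell D ^ 11) :
    Eq1311Rel c' c₀ := by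
  intro ε hε
  obtain ⟨C23, h23⟩ := hZ23
  obtain ⟨CB, hCB0, hB⟩ := hZB
  obtain ⟨CL, hL⟩ := hZL
  obtain ⟨CNB, hCNB0, hNB⟩ := hZNB
  obtain ⟨CDB, hCDB0, hDB⟩ := hZDB
  obtain ⟨CN, hCN0, hN⟩ := hZN
  -- non-negative versions of the two constants without a sign hypothesis
  set C23' : ℝ := max C23 0 with hC23'
  set CL' : ℝ := max CL 0 with hCL'
  have hC23'0 : 0 ≤ C23' := le_max_right _ _
  have hCL'0 : 0 ≤ CL' := le_max_right _ _
  -- the total constant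
  set K : ℝ := Real.sqrt (2 * C23' * CB) + (Real.sqrt (CL' * CNB) + Real.sqrt (CN * CNB)) +
    2 * Real.sqrt π * (Real.sqrt (CL' * CDB) + Real.sqrt (CN * CDB)) +
    256 / c₀ ^ 4 * (Real.sqrt (CL' * CB) + Real.sqrt (CN * CB)) with hK
  have hK0 : 0 ≤ K := by positivity
  -- thresholds
  obtain ⟨D₁, hD₁⟩ := ((((h23.and hB).and hL).and hNB).and hDB).and hN
  obtain ⟨D₂, hD₂⟩ := Typed.Sec14.Eq143.bigP_sq_le
  obtain ⟨D₃, hD₃⟩ := beta_small c'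
  obtain ⟨D₄, hD₄⟩ := Filter.eventually_atTop.mp
    (tendsto_ell_atTop.eventually (eventually_ge_atTop (max 4 (K / ε + 1))))
  refine ⟨max (max D₁ D₂) (max D₃ D₄), fun D _ χ hD hq hp hA => ?_⟩
  have hD1 : D₁ ≤ D := le_trans (le_trans (le_max_left _ _) (le_max_left _ _)) hD
  have hD2 : D₂ ≤ D := le_trans (le_trans (le_max_right _ _) (le_max_left _ _)) hD
  have hD3 : D₃ ≤ D := le_trans (le_trans (le_max_left _ _) (le_max_right _ _)) hD
  have hD4 : D₄ ≤ D := le_trans (le_trans (le_max_right _ _) (le_max_right _ _)) hD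
  obtain ⟨⟨⟨⟨⟨e23, eB⟩, eL⟩, eNB⟩, eDB⟩, eN⟩ := hD₁ D χ hD1 hq hp
  have hPsq : bigP D ^ 2 ≤ 2 * frakP D * ell D ^ 77 := hD₂ D hD2
  obtain ⟨-, hb2, hb3, -⟩ := hD₃ D hD3
  have hℓK : max 4 (K / ε + 1) ≤ ell D := hD₄ D hD4
  have hℓ4 : 4 ≤ ell D := le_trans (le_max_left _ _) hℓK
  have hℓ1 : 1 ≤ ell D := by linarith
  have hℓ0 : 0 < ell D := by linarith
  have hP0 : 0 ≤ frakP D := frakP_nonneg D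
  have hA0 : 0 ≤ frakA χ := frakA_nonneg χ
  set ℓ := ell D with hℓdef
  set X := frakP D with hXdef
  -- the eight bounds at this `D`
  have q23 : ∑ x ∈ finsetOf (PsiOne χ), ∑ ρ ∈ finsetOf (zeroSet D x),
      ‖x.ψ.LFunction (ρ + beta1 c' D) / deriv x.ψ.LFunction ρ‖ *
        ‖x.ψ.LFunction (ρ + beta2 c' D) * x.ψ.LFunction (ρ + beta3 c' D)‖ ^ 2 * ‖omegaW D ρ‖ ≤
      (2 * C23') * X * ℓ ^ 122 := by
    refine (e23 hA).trans ?_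
    calc C23 * bigP D ^ 2 * ell D ^ 45 ≤ C23' * bigP D ^ 2 * ell D ^ 45 := by
          gcongr; exact le_max_left _ _
      _ ≤ C23' * (2 * frakP D * ell D ^ 77) * ell D ^ 45 := by gcongr
      _ = (2 * C23') * X * ℓ ^ 122 := by rw [hXdef, hℓdef]; ring
  have qB := eB
  have qL2 : ∑ x ∈ finsetOf (PsiOne χ), ∑ ρ ∈ finsetOf (zeroSet D x),
      ‖x.ψ.LFunction (ρ + beta1 c' D) / deriv x.ψ.LFunction ρ‖ *
        ‖x.ψ.LFunction (ρ + beta2 c' D)‖ ^ 2 * ‖omegaW D ρ‖ ≤ CL' * X * ℓ ^ 18 := by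
    refine (eL hA (beta2 c' D) (beta2_re c' D) hb2).trans ?_
    gcongr; exact le_max_left _ _
  have qN3B := eNB (beta3 c' D) (beta3_re c' D)
  have qN2B := eNB (beta2 c' D) (beta2_re c' D)
  have qN3 := eN (beta3 c' D) (beta3_re c' D)
  have qD : ∀ (β₀ : ℂ), β₀.re = 0 → ∀ v : ℝ, |v| ≤ ell D ^ 20 →
      ∑ x ∈ finsetOf (PsiOne χ), ∑ ρ ∈ finsetOf (zeroSet D x),
        ‖x.ψ.LFunction (ρ + beta1 c' D) / deriv x.ψ.LFunction ρ‖ *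
          ‖(∑ n ∈ Finset.Ico 1 ⌈bigT D ^ 3⌉₊, x.ψ (n : ZMod x.p) * (n : ℂ) ^ (-(ρ + β₀ + v * I))) *
            Bpoly χ x ρ‖ ^ 2 * ‖omegaW D ρ‖ ≤ CDB * X * ℓ ^ 55 := by
    intro β₀ hβ₀ v _
    have hre : (β₀ + v * I).re = 0 := by simp [hβ₀]
    have h := eDB (β₀ + v * I) hre
    refine le_of_eq_of_le (Finset.sum_congr rfl fun x _ => Finset.sum_congr rfl fun ρ _ => ?_) h
    rw [add_assoc]
  -- the interface
  have hmain := frakE_le_of_zeroSum_bounds c' c₀ χ hℓ0 q23 qB qL2 qN3B qN3 qN2B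
    (qD (beta3 c' D) (beta3_re c' D)) (qD (beta2 c' D) (beta2_re c' D))
  -- powers of `𝓛`
  have hpow : ∀ {m n : ℕ}, n + 8 ≤ m → (ℓ ^ m)⁻¹ * ℓ ^ n ≤ (ℓ ^ 8)⁻¹ := by
    intro m n hmn
    have hm : 0 < ℓ ^ m := pow_pos hℓ0 m
    have h8 : 0 < ℓ ^ 8 := pow_pos hℓ0 8
    rw [inv_mul_le_iff₀ hm, ← div_eq_mul_inv, le_div_iff₀ h8, ← pow_add]
    exact pow_le_pow_right₀ hℓ1 hmn
  -- the square-root products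
  have r1 := sqrt_mul_sqrt_le (by positivity : (0 : ℝ) ≤ 2 * C23') hCB0 hP0 hℓ1
    (a := 122) (b := 45) (k := 84) (by norm_num)
  have r2 := sqrt_mul_sqrt_le hCL'0 hCNB0 hP0 hℓ1 (a := 18) (b := 55) (k := 37) (by norm_num)
  have r3 := sqrt_mul_sqrt_le hCN0 hCNB0 hP0 hℓ1 (a := 11) (b := 55) (k := 37) (by norm_num)
  have r4 := sqrt_mul_sqrt_le hCL'0 hCDB0 hP0 hℓ1 (a := 18) (b := 55) (k := 37) (by norm_num)
  have r5 := sqrt_mul_sqrt_le hCN0 hCDB0 hP0 hℓ1 (a := 11) (b := 55) (k := 37) (by norm_num)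
  have r6 := sqrt_mul_sqrt_le hCL'0 hCB0 hP0 hℓ1 (a := 18) (b := 45) (k := 32) (by norm_num)
  have r7 := sqrt_mul_sqrt_le hCN0 hCB0 hP0 hℓ1 (a := 11) (b := 45) (k := 32) (by norm_num)
  -- group 1: `t₀⁻¹ = 𝓛⁻⁵¹⁹`
  have g1 : (t0 D)⁻¹ * (Real.sqrt (2 * C23' * X * ℓ ^ 122) * Real.sqrt (CB * X * ℓ ^ 45)) ≤
      Real.sqrt (2 * C23' * CB) * X * (ℓ ^ 8)⁻¹ := by
    have ht : (t0 D)⁻¹ = (ℓ ^ 519)⁻¹ := by rw [t0]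
    rw [ht]
    calc (ℓ ^ 519)⁻¹ * (Real.sqrt (2 * C23' * X * ℓ ^ 122) * Real.sqrt (CB * X * ℓ ^ 45))
        ≤ (ℓ ^ 519)⁻¹ * (Real.sqrt (2 * C23' * CB) * X * ℓ ^ 84) :=
          mul_le_mul_of_nonneg_left r1 (by positivity)
      _ = Real.sqrt (2 * C23' * CB) * X * ((ℓ ^ 519)⁻¹ * ℓ ^ 84) := by ring
      _ ≤ Real.sqrt (2 * C23' * CB) * X * (ℓ ^ 8)⁻¹ :=
          mul_le_mul_of_nonneg_left (hpow (by norm_num)) (by positivity)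
  -- group 2: `𝓛⁻¹²³`
  have g2 : (ell D ^ 123)⁻¹ * (Real.sqrt (CL' * X * ℓ ^ 18) * Real.sqrt (CNB * X * ℓ ^ 55) +
        Real.sqrt (CN * X * ℓ ^ 11) * Real.sqrt (CNB * X * ℓ ^ 55)) ≤
      (Real.sqrt (CL' * CNB) + Real.sqrt (CN * CNB)) * X * (ℓ ^ 8)⁻¹ := by
    calc (ell D ^ 123)⁻¹ * (Real.sqrt (CL' * X * ℓ ^ 18) * Real.sqrt (CNB * X * ℓ ^ 55) +
          Real.sqrt (CN * X * ℓ ^ 11) * Real.sqrt (CNB * X * ℓ ^ 55))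
        ≤ (ℓ ^ 123)⁻¹ * (Real.sqrt (CL' * CNB) * X * ℓ ^ 37 + Real.sqrt (CN * CNB) * X * ℓ ^ 37) :=
          mul_le_mul_of_nonneg_left (add_le_add r2 r3) (by positivity)
      _ = (Real.sqrt (CL' * CNB) + Real.sqrt (CN * CNB)) * X * ((ℓ ^ 123)⁻¹ * ℓ ^ 37) := by ring
      _ ≤ (Real.sqrt (CL' * CNB) + Real.sqrt (CN * CNB)) * X * (ℓ ^ 8)⁻¹ :=
          mul_le_mul_of_nonneg_left (hpow (by norm_num)) (by positivity)
  -- group 3: `𝓛⁻⁶⁸·2√π𝓛¹⁵`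
  have g3 : (ell D ^ 68)⁻¹ * (2 * Real.sqrt π * ell D ^ 15) *
        (Real.sqrt (CL' * X * ℓ ^ 18) * Real.sqrt (CDB * X * ℓ ^ 55) +
          Real.sqrt (CN * X * ℓ ^ 11) * Real.sqrt (CDB * X * ℓ ^ 55)) ≤
      2 * Real.sqrt π * (Real.sqrt (CL' * CDB) + Real.sqrt (CN * CDB)) * X * (ℓ ^ 8)⁻¹ := by
    calc (ell D ^ 68)⁻¹ * (2 * Real.sqrt π * ell D ^ 15) *
          (Real.sqrt (CL' * X * ℓ ^ 18) * Real.sqrt (CDB * X * ℓ ^ 55) +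
            Real.sqrt (CN * X * ℓ ^ 11) * Real.sqrt (CDB * X * ℓ ^ 55))
        ≤ (ℓ ^ 68)⁻¹ * (2 * Real.sqrt π * ℓ ^ 15) *
            (Real.sqrt (CL' * CDB) * X * ℓ ^ 37 + Real.sqrt (CN * CDB) * X * ℓ ^ 37) :=
          mul_le_mul_of_nonneg_left (add_le_add r4 r5) (by positivity)
      _ = 2 * Real.sqrt π * (Real.sqrt (CL' * CDB) + Real.sqrt (CN * CDB)) * X *
            ((ℓ ^ 68)⁻¹ * ℓ ^ 52) := by ring
      _ ≤ 2 * Real.sqrt π * (Real.sqrt (CL' * CDB) + Real.sqrt (CN * CDB)) * X * (ℓ ^ 8)⁻¹ :=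
          mul_le_mul_of_nonneg_left (hpow (by norm_num)) (by positivity)
  -- group 4: `e^{−c₀𝓛¹⁰}`
  have g4 : Real.exp (-c₀ * ell D ^ 10) *
        (Real.sqrt (CL' * X * ℓ ^ 18) * Real.sqrt (CB * X * ℓ ^ 45) +
          Real.sqrt (CN * X * ℓ ^ 11) * Real.sqrt (CB * X * ℓ ^ 45)) ≤
      256 / c₀ ^ 4 * (Real.sqrt (CL' * CB) + Real.sqrt (CN * CB)) * X * (ℓ ^ 8)⁻¹ := by
    have hexp := exp_neg_mul_mul_pow_four_le hc₀ (pow_nonneg hℓ0.le 10)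
    have h8ne : ℓ ^ 8 ≠ 0 := pow_ne_zero 8 hℓ0.ne'
    have hl32 : ℓ ^ 32 = (ℓ ^ 10) ^ 4 * (ℓ ^ 8)⁻¹ := by
      rw [eq_mul_inv_iff_mul_eq₀ h8ne]; ring
    have h32 : Real.exp (-c₀ * ℓ ^ 10) * ℓ ^ 32 =
        Real.exp (-c₀ * ℓ ^ 10) * (ℓ ^ 10) ^ 4 * (ℓ ^ 8)⁻¹ := by
      rw [hl32]; ring
    calc Real.exp (-c₀ * ell D ^ 10) *
          (Real.sqrt (CL' * X * ℓ ^ 18) * Real.sqrt (CB * X * ℓ ^ 45) +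
            Real.sqrt (CN * X * ℓ ^ 11) * Real.sqrt (CB * X * ℓ ^ 45))
        ≤ Real.exp (-c₀ * ℓ ^ 10) *
            (Real.sqrt (CL' * CB) * X * ℓ ^ 32 + Real.sqrt (CN * CB) * X * ℓ ^ 32) :=
          mul_le_mul_of_nonneg_left (add_le_add r6 r7) (Real.exp_pos _).le
      _ = (Real.sqrt (CL' * CB) + Real.sqrt (CN * CB)) * X * (Real.exp (-c₀ * ℓ ^ 10) * ℓ ^ 32) := by
          ring
      _ = (Real.sqrt (CL' * CB) + Real.sqrt (CN * CB)) * X *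
            (Real.exp (-c₀ * ℓ ^ 10) * (ℓ ^ 10) ^ 4 * (ℓ ^ 8)⁻¹) := by rw [h32]
      _ ≤ (Real.sqrt (CL' * CB) + Real.sqrt (CN * CB)) * X * (256 / c₀ ^ 4 * (ℓ ^ 8)⁻¹) :=
          mul_le_mul_of_nonneg_left (mul_le_mul_of_nonneg_right hexp (by positivity)) (by positivity)
      _ = 256 / c₀ ^ 4 * (Real.sqrt (CL' * CB) + Real.sqrt (CN * CB)) * X * (ℓ ^ 8)⁻¹ := by ring
  -- total
  have htot' : frakE c' c₀ χ ≤ Real.sqrt (2 * C23' * CB) * X * (ℓ ^ 8)⁻¹ +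
      (Real.sqrt (CL' * CNB) + Real.sqrt (CN * CNB)) * X * (ℓ ^ 8)⁻¹ +
      2 * Real.sqrt π * (Real.sqrt (CL' * CDB) + Real.sqrt (CN * CDB)) * X * (ℓ ^ 8)⁻¹ +
      256 / c₀ ^ 4 * (Real.sqrt (CL' * CB) + Real.sqrt (CN * CB)) * X * (ℓ ^ 8)⁻¹ := by
    linarith [hmain, g1, g2, g3, g4]
  have htot : frakE c' c₀ χ ≤ K * X * (ℓ ^ 8)⁻¹ := by
    refine htot'.trans (le_of_eq ?_)
    rw [hK]; ring
  -- `K·𝓛⁻⁸ ≤ ε`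
  have hKε : K * (ℓ ^ 8)⁻¹ ≤ ε := by
    have hℓε : K / ε + 1 ≤ ℓ := le_trans (le_max_right _ _) hℓK
    have h8 : ℓ ≤ ℓ ^ 8 := le_self_pow₀ hℓ1 (by norm_num)
    have hKle : K ≤ ε * ℓ ^ 8 := by
      have : K / ε ≤ ℓ ^ 8 := by linarith
      rwa [div_le_iff₀ hε, mul_comm] at this
    rw [mul_inv_le_iff₀ (pow_pos hℓ0 8)]
    linarith
  calc frakE c' c₀ χ ≤ K * X * (ℓ ^ 8)⁻¹ := htot
    _ = (K * (ℓ ^ 8)⁻¹) * X := by ring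
    _ ≤ ε * X := mul_le_mul_of_nonneg_right hKε hP0
    _ ≤ ε * (frakA χ + 1) * frakP D := by
        rw [mul_assoc]
        exact mul_le_mul_of_nonneg_left (le_mul_of_one_le_left hP0 (by linarith)) hε.le

end Literature.NumberTheory.LFunctions.Zhang2022.Typed.Section13
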